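import Literature.NumberTheory.EllipticCurves.H1CorestrictionIndexTwo
import HarnessLib

/-!
# `H¹` of a module with trivial action: one cocycle in each class (Clark–Sharif 2010, §3.5)

Generic continuous group cohomology (no number theory), on the tree's model of `H¹_cont(G, M)`
for a topological group `G` and a discrete `G`-module `M`
(`Literature.NumberTheory.EllipticCurves.discreteH1` = Mathlib's `continuousCohomology 1`, explicit
continuous crossed homomorphisms `Literature.NumberTheory.GaloisRepresentations.contOneCocycles`
and their classes `oneCocycleClass`, file `GaloisRepresentations/ContinuousH1`; `classHom`,
`liftH1` of file `H1CorestrictionIndexTwo`).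

When `G` acts **trivially** on `M` — hypothesis `htriv : ∀ (g : G) (m : M), g • m = m`, stated as
a proposition rather than an instance so that it applies verbatim to the action of a subgroup
`N ≤ G` on a `G`-module fixed pointwise by `N` only (`Subgroup.smul_def`), the situation of
Clark–Sharif's `𝔤_{K_P} ≤ 𝔤_K` acting on `E[P] ⊂ E(K_P)` —

* a crossed homomorphism is a homomorphism: `f(ab) = f(a) + f(b)` (`cocycle_map_mul_of_trivial`),
  and conversely every continuous additive map `G → M` is a continuous cocycle (`homCocycle`);
* the only coboundary is `0` (`g • v - v = 0`), so **`[f] = 0 ↔ f = 0`**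
  (`oneCocycleClass_eq_zero_iff_of_trivial`), the class map `Z¹_cont(G, M) → H¹_cont(G, M)` is
  injective (`classHom_injective_of_trivial`) and hence an isomorphism
  **`classEquivOfTrivial : Z¹_cont(G, M) ≃+ H¹_cont(G, M)`** ("there is a unique cocycle in each
  cohomology class", `existsUnique_oneCocycleClass_eq`; its inverse `cocycleOf`);
* for the discrete topology on `M`, an additive map `f : G → M` is continuous iff its kernel is
  open, iff it vanishes on some open neighbourhood of `1` (`continuous_iff_isOpen_ker_of_map_mul`,
  `continuous_of_map_mul_of_forall_mem_eq_zero`): `H¹_cont(G, M) = Hom_cont(G, M)` is the group of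
  homomorphisms with open kernel.

This is the remark of Clark–Sharif 2010, §3.5, on which their endomorphism `Nm` of
`H¹(K_P, E[P])` and the proof of Proposition 16 rest: "Since `E[P]` is rational over `K_P`, there
is a unique cocycle in each cohomology class, so that `Nm` is well-defined as an endomorphism of
`H¹(K_P, E[P])`"; "Since in either case `M` is a trivial `G_{K_P}`-module, the set of
coboundaries `B¹(K_P, M)` is zero, and so `H¹(K_P, M) = Z¹(K_P, M)`, the set of 1-cocycles from
`G_{K_P}` to `M`. We can therefore identify cohomology classes with cocycles" (proof of their
Theorem 2, vendored as the named fact `Literature.NumberTheory.EllipticCurves.ClarkSharif2010_thm2`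
of file `PeriodIndex`). Everything here is proved; no named fact is introduced.

## References

* J.-P. Serre, *Galois Cohomology* (1997), I.§2.2–2.3 (cochains, cocycles, `H¹`); for a trivial
  module `H¹(G, A) = Hom(G, A)` (continuous homomorphisms), I.§2.3, Remark. [SerreGaloisCohomology1997]
* J. Neukirch, A. Schmidt, K. Wingberg, *Cohomology of Number Fields*, 2nd ed. (2008), (1.2),
  I.§2 (`H¹(G, A) = Hom_cts(G, A)` for trivial `A`). [NeukirchSchmidtWingberg2008]
* P. L. Clark, S. Sharif, *Period, index and potential Ш*, Algebra & Number Theory 4 (2010),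
  §3.5. [ClarkSharif2010]
-/

noncomputable section

open scoped Classical

universe u

namespace Literature.NumberTheory.EllipticCurves

open GaloisRepresentations

variable {G : Type u} [Group G] [TopologicalSpace G] [IsTopologicalGroup G]
variable {M : Type u} [AddCommGroup M] [DistribMulAction G M] [TopologicalSpace M]
  [DiscreteTopology M]

/-! ## Continuous additive maps into a discrete group -/

section Continuity

omit [TopologicalSpace G] [IsTopologicalGroup G] [DistribMulAction G M] [TopologicalSpace M]
  [DiscreteTopology M] in
/-- An additive map out of a group kills `1`. [folklore] -/
theorem map_one_eq_zero_of_map_mul {f : G → M} (hf : ∀ a b, f (a * b) = f a + f b) : f 1 = 0 := by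
  have h := hf 1 1
  rw [mul_one] at h
  exact left_eq_add.mp h

omit [TopologicalSpace G] [IsTopologicalGroup G] [DistribMulAction G M] [TopologicalSpace M]
  [DiscreteTopology M] in
/-- An additive map out of a group is odd: `f a⁻¹ = -f a`. [folklore] -/
theorem map_inv_eq_neg_of_map_mul' {f : G → M} (hf : ∀ a b, f (a * b) = f a + f b) (a : G) :
    f a⁻¹ = -f a := by
  have h := hf a⁻¹ a
  rw [inv_mul_cancel, map_one_eq_zero_of_map_mul hf] at h
  exact eq_neg_of_add_eq_zero_left h.symm

omit [DistribMulAction G M] [DiscreteTopology M] in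
/-- **An additive map into a discrete group vanishing on a neighbourhood of `1` is continuous**:
its fibre through `g` contains the open set `g U`. (For `U` an open subgroup this is the usual
"homomorphisms trivial on an open subgroup are continuous".) Serre, *Galois Cohomology*, I.§2.3;
Neukirch–Schmidt–Wingberg, I.§2. [folklore] -/
theorem continuous_of_map_mul_of_forall_mem_eq_zero {f : G → M} (hf : ∀ a b, f (a * b) = f a + f b)
    (U : Set G) (hU : IsOpen U) (h1 : (1 : G) ∈ U) (hU0 : ∀ u ∈ U, f u = 0) : Continuous f := by
  refine continuous_def.mpr fun s _ ↦ isOpen_iff_forall_mem_open.mpr fun g hg ↦ ?_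
  refine ⟨(fun u ↦ g * u) '' U, ?_, isOpenMap_mul_left g U hU, ⟨1, h1, mul_one g⟩⟩
  rintro _ ⟨u, hu, rfl⟩
  change f (g * u) ∈ s
  rw [hf, hU0 u hu, add_zero]
  exact hg

omit [DistribMulAction G M] [DiscreteTopology M] in
/-- An additive map (into a discrete group) with open kernel is continuous. Serre, *Galois
Cohomology*, I.§2.3. [folklore] -/
theorem continuous_of_map_mul_of_isOpen_ker {f : G → M} (hf : ∀ a b, f (a * b) = f a + f b)
    (hker : IsOpen {g : G | f g = 0}) : Continuous f :=
  continuous_of_map_mul_of_forall_mem_eq_zero hf _ hker (map_one_eq_zero_of_map_mul hf)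
    fun _ hu ↦ hu

omit [Group G] [IsTopologicalGroup G] [DistribMulAction G M] in
/-- The kernel of a continuous map into a discrete group is open. [folklore] -/
theorem isOpen_ker_of_continuous {f : G → M} (hc : Continuous f) : IsOpen {g : G | f g = 0} :=
  (isOpen_discrete ({0} : Set M)).preimage hc

omit [DistribMulAction G M] in
/-- **Continuity of an additive map into a discrete group is openness of its kernel.**
Serre, *Galois Cohomology*, I.§2.3; Neukirch–Schmidt–Wingberg, I.§2. [folklore] -/
theorem continuous_iff_isOpen_ker_of_map_mul {f : G → M} (hf : ∀ a b, f (a * b) = f a + f b) :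
    Continuous f ↔ IsOpen {g : G | f g = 0} :=
  ⟨isOpen_ker_of_continuous, continuous_of_map_mul_of_isOpen_ker hf⟩

omit [DistribMulAction G M] [DiscreteTopology M] in
/-- An additive map (into a discrete group) vanishing on an open subgroup is continuous.
Serre, *Galois Cohomology*, I.§2.3. [folklore] -/
theorem continuous_of_map_mul_of_subgroup {f : G → M} (hf : ∀ a b, f (a * b) = f a + f b)
    (U : Subgroup G) (hU : IsOpen (U : Set G)) (hU0 : ∀ u ∈ U, f u = 0) : Continuous f :=
  continuous_of_map_mul_of_forall_mem_eq_zero hf U hU U.one_mem hU0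

end Continuity

/-! ## Cocycles for a trivial action are homomorphisms -/

section TrivialAction

omit [TopologicalSpace G] [IsTopologicalGroup G] [TopologicalSpace M] [DiscreteTopology M] in
/-- Under a trivial action every orbit map `g ↦ g • m` is constant, hence continuous (the
hypothesis `hM` of the corestriction files is automatic). [folklore] -/
theorem continuous_smul_of_trivial [TopologicalSpace G] [TopologicalSpace M]
    (htriv : ∀ (g : G) (m : M), g • m = m) (m : M) : Continuous fun g : G ↦ g • m := by
  simp_rw [htriv]
  exact continuous_const

omit [IsTopologicalGroup G] in
/-- **For a trivial action a crossed homomorphism is a homomorphism**: `f(ab) = f(a) + f(b)`.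
Serre, *Galois Cohomology*, I.§2.3; Clark–Sharif 2010, §3.5. [folklore] -/
theorem cocycle_map_mul_of_trivial (htriv : ∀ (g : G) (m : M), g • m = m)
    (f : contOneCocycles (discreteTopRep G M)) (a b : G) : f.1 (a * b) = f.1 a + f.1 b := by
  rw [cocycle_mul' f a b, htriv]

omit [IsTopologicalGroup G] in
/-- For a trivial action, `f a⁻¹ = -f a`. [folklore] -/
theorem cocycle_map_inv_of_trivial (htriv : ∀ (g : G) (m : M), g • m = m)
    (f : contOneCocycles (discreteTopRep G M)) (a : G) : f.1 a⁻¹ = -f.1 a :=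
  map_inv_eq_neg_of_map_mul' (cocycle_map_mul_of_trivial htriv f) a

omit [IsTopologicalGroup G] in
/-- For a trivial action, cocycles are constant on conjugacy classes: `f(c a c⁻¹) = f(a)`.
[folklore] -/
theorem cocycle_map_conj_of_trivial (htriv : ∀ (g : G) (m : M), g • m = m)
    (f : contOneCocycles (discreteTopRep G M)) (c a : G) : f.1 (c * a * c⁻¹) = f.1 a := by
  rw [cocycle_map_mul_of_trivial htriv, cocycle_map_mul_of_trivial htriv,
    cocycle_map_inv_of_trivial htriv, add_comm (f.1 c), add_neg_cancel_right]

omit [IsTopologicalGroup G] in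
/-- **A continuous additive map `G → M` is a continuous cocycle** when the action is trivial.
Serre, *Galois Cohomology*, I.§2.3 (`H¹(G, A) = Hom(G, A)` for trivial `A`). [folklore] -/
def homCocycle (htriv : ∀ (g : G) (m : M), g • m = m) (f : G → M)
    (hf : ∀ a b, f (a * b) = f a + f b) (hc : Continuous f) :
    contOneCocycles (discreteTopRep G M) :=
  ⟨⟨f, hc⟩, fun a b ↦ by
    change f (a * b) = f a + a • f b
    rw [hf, htriv]⟩

omit [IsTopologicalGroup G] in
/-- Values of `homCocycle`. [folklore] -/
@[simp]
theorem homCocycle_apply (htriv : ∀ (g : G) (m : M), g • m = m) (f : G → M)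
    (hf : ∀ a b, f (a * b) = f a + f b) (hc : Continuous f) (g : G) :
    (homCocycle htriv f hf hc).1 g = f g :=
  rfl

omit [IsTopologicalGroup G] in
/-- Every cocycle is the `homCocycle` of its own (additive, continuous) underlying map. [folklore] -/
theorem homCocycle_coe (htriv : ∀ (g : G) (m : M), g • m = m)
    (f : contOneCocycles (discreteTopRep G M)) :
    homCocycle htriv f.1 (cocycle_map_mul_of_trivial htriv f) f.1.continuous = f :=
  Subtype.ext (ContinuousMap.ext fun _ ↦ rfl)

/-- **For a trivial action the only coboundary is zero**: `[f] = 0 ↔ f = 0`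
(`oneCocycleClass_eq_zero_iff`: `[f] = 0 ↔ f = ∂v = (g ↦ g • v - v)`, and `g • v - v = 0`).
Clark–Sharif 2010, §3.5 ("the set of coboundaries `B¹(K_P, M)` is zero"); Serre, *Galois
Cohomology*, I.§2.3. [cite: ClarkSharif2010, §3.5] -/
theorem oneCocycleClass_eq_zero_iff_of_trivial (htriv : ∀ (g : G) (m : M), g • m = m)
    (f : contOneCocycles (discreteTopRep G M)) :
    oneCocycleClass (discreteTopRep G M) f = 0 ↔ f = 0 := by
  rw [oneCocycleClass_eq_zero_iff]
  constructor
  · rintro ⟨v, hv⟩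
    apply Subtype.ext
    ext g
    have h : f.1 g = g • v - v := hv g
    rw [htriv, sub_self] at h
    exact h
  · rintro rfl
    exact ⟨0, fun g ↦ (show (0 : M) = g • (0 : M) - 0 by rw [smul_zero, sub_zero])⟩

/-- **The class map `Z¹ → H¹` is injective for a trivial action.** Clark–Sharif 2010, §3.5
("there is a unique cocycle in each cohomology class"). [cite: ClarkSharif2010, §3.5] -/
theorem classHom_injective_of_trivial (htriv : ∀ (g : G) (m : M), g • m = m) :
    Function.Injective (classHom G M) := by
  intro f g h
  rw [classHom_apply, classHom_apply] at h
  rw [← sub_eq_zero, ← oneCocycleClass_eq_zero_iff_of_trivial htriv, oneCocycleClass_sub, h,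
    sub_self]

/-- Equal classes have equal cocycles (trivial action). [cite: ClarkSharif2010, §3.5] -/
theorem eq_of_oneCocycleClass_eq (htriv : ∀ (g : G) (m : M), g • m = m)
    {f g : contOneCocycles (discreteTopRep G M)}
    (h : oneCocycleClass (discreteTopRep G M) f = oneCocycleClass (discreteTopRep G M) g) : f = g :=
  classHom_injective_of_trivial htriv h

/-- For a trivial action, `[f] = [g] ↔ f = g`. [cite: ClarkSharif2010, §3.5] -/
theorem oneCocycleClass_eq_iff_of_trivial (htriv : ∀ (g : G) (m : M), g • m = m)
    (f g : contOneCocycles (discreteTopRep G M)) :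
    oneCocycleClass (discreteTopRep G M) f = oneCocycleClass (discreteTopRep G M) g ↔ f = g :=
  ⟨eq_of_oneCocycleClass_eq htriv, fun h ↦ h ▸ rfl⟩

variable (G M) in
/-- **`H¹_cont(G, M) = Z¹_cont(G, M)` for a trivial action**: the class map is an isomorphism of
the group of continuous crossed homomorphisms ( = continuous homomorphisms,
`cocycle_map_mul_of_trivial`, `homCocycle`) onto `H¹`. Serre, *Galois Cohomology*, I.§2.3;
Neukirch–Schmidt–Wingberg, I.§2; Clark–Sharif 2010, §3.5 ("`H¹(K_P, M) = Z¹(K_P, M)` … We can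
therefore identify cohomology classes with cocycles"). [cite: ClarkSharif2010, §3.5] -/
def classEquivOfTrivial (htriv : ∀ (g : G) (m : M), g • m = m) :
    contOneCocycles (discreteTopRep G M) ≃+ discreteH1 G M :=
  AddEquiv.ofBijective (classHom G M) ⟨classHom_injective_of_trivial htriv, classHom_surjective⟩

/-- `classEquivOfTrivial f = [f]`. [folklore] -/
@[simp]
theorem classEquivOfTrivial_apply (htriv : ∀ (g : G) (m : M), g • m = m)
    (f : contOneCocycles (discreteTopRep G M)) :
    classEquivOfTrivial G M htriv f = oneCocycleClass (discreteTopRep G M) f :=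
  rfl

variable (G M) in
/-- **The cocycle of a class** (trivial action): the inverse of `classEquivOfTrivial`.
Clark–Sharif 2010, §3.5. [cite: ClarkSharif2010, §3.5] -/
def cocycleOf (htriv : ∀ (g : G) (m : M), g • m = m) (η : discreteH1 G M) :
    contOneCocycles (discreteTopRep G M) :=
  (classEquivOfTrivial G M htriv).symm η

/-- `[cocycleOf η] = η`. [folklore] -/
@[simp]
theorem oneCocycleClass_cocycleOf (htriv : ∀ (g : G) (m : M), g • m = m) (η : discreteH1 G M) :
    oneCocycleClass (discreteTopRep G M) (cocycleOf G M htriv η) = η :=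
  (classEquivOfTrivial G M htriv).apply_symm_apply η

/-- `cocycleOf [f] = f`. [folklore] -/
@[simp]
theorem cocycleOf_oneCocycleClass (htriv : ∀ (g : G) (m : M), g • m = m)
    (f : contOneCocycles (discreteTopRep G M)) :
    cocycleOf G M htriv (oneCocycleClass (discreteTopRep G M) f) = f :=
  (classEquivOfTrivial G M htriv).symm_apply_apply f

/-- `cocycleOf` is additive. [folklore] -/
theorem cocycleOf_add (htriv : ∀ (g : G) (m : M), g • m = m) (η η' : discreteH1 G M) :
    cocycleOf G M htriv (η + η') = cocycleOf G M htriv η + cocycleOf G M htriv η' :=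
  map_add _ η η'

/-- **"There is a unique cocycle in each cohomology class"** (trivial action).
Clark–Sharif 2010, §3.5. [cite: ClarkSharif2010, §3.5] -/
theorem existsUnique_oneCocycleClass_eq (htriv : ∀ (g : G) (m : M), g • m = m)
    (η : discreteH1 G M) :
    ∃! f : contOneCocycles (discreteTopRep G M), oneCocycleClass (discreteTopRep G M) f = η :=
  ⟨cocycleOf G M htriv η, oneCocycleClass_cocycleOf htriv η, fun _ hf ↦
    eq_of_oneCocycleClass_eq htriv (hf.trans (oneCocycleClass_cocycleOf htriv η).symm)⟩

/-- Two classes are equal iff their cocycles agree pointwise (trivial action): `H¹_cont(G, M)`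
embeds in the functions `G → M`. [folklore] -/
theorem ext_of_trivial (htriv : ∀ (g : G) (m : M), g • m = m) {η η' : discreteH1 G M}
    (h : ∀ g, (cocycleOf G M htriv η).1 g = (cocycleOf G M htriv η').1 g) : η = η' := by
  have hc : cocycleOf G M htriv η = cocycleOf G M htriv η' := Subtype.ext (ContinuousMap.ext h)
  rw [← oneCocycleClass_cocycleOf htriv η, ← oneCocycleClass_cocycleOf htriv η', hc]

/-- **Maps out of `H¹` for a trivial action need no coboundary check**: any additive map on
cocycles descends (`liftH1` with the vacuous hypothesis). [folklore] -/
def liftH1OfTrivial (htriv : ∀ (g : G) (m : M), g • m = m) {X : Type*} [AddCommGroup X]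
    (φ : contOneCocycles (discreteTopRep G M) →+ X) : discreteH1 G M →+ X :=
  liftH1 φ fun f hf ↦ by
    rw [(oneCocycleClass_eq_zero_iff_of_trivial htriv f).mp hf, map_zero]

/-- `liftH1OfTrivial φ [f] = φ f`. [folklore] -/
@[simp]
theorem liftH1OfTrivial_oneCocycleClass (htriv : ∀ (g : G) (m : M), g • m = m) {X : Type*}
    [AddCommGroup X] (φ : contOneCocycles (discreteTopRep G M) →+ X)
    (f : contOneCocycles (discreteTopRep G M)) :
    liftH1OfTrivial htriv φ (oneCocycleClass (discreteTopRep G M) f) = φ f :=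
  liftH1_oneCocycleClass φ _ f

/-- **Evaluation at `g ∈ G` is a homomorphism `H¹_cont(G, M) → M`** for a trivial action
(`η ↦ f_η(g)` for the unique cocycle `f_η` of `η`). [folklore] -/
def evalH1 (htriv : ∀ (g : G) (m : M), g • m = m) (g : G) : discreteH1 G M →+ M where
  toFun η := (cocycleOf G M htriv η).1 g
  map_zero' := by rw [← oneCocycleClass_zero, cocycleOf_oneCocycleClass]; rfl
  map_add' η η' := by rw [cocycleOf_add]; rfl

/-- `evalH1 g [f] = f g`. [folklore] -/
@[simp]
theorem evalH1_oneCocycleClass (htriv : ∀ (g : G) (m : M), g • m = m) (g : G)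
    (f : contOneCocycles (discreteTopRep G M)) :
    evalH1 htriv g (oneCocycleClass (discreteTopRep G M) f) = f.1 g := by
  change (cocycleOf G M htriv (oneCocycleClass (discreteTopRep G M) f)).1 g = f.1 g
  rw [cocycleOf_oneCocycleClass]

/-- The evaluations are jointly injective and multiplicative in `g`:
`evalH1 (a b) = evalH1 a + evalH1 b`. [folklore] -/
theorem evalH1_mul (htriv : ∀ (g : G) (m : M), g • m = m) (a b : G) (η : discreteH1 G M) :
    evalH1 htriv (a * b) η = evalH1 htriv a η + evalH1 htriv b η :=
  cocycle_map_mul_of_trivial htriv _ a b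

end TrivialAction

/-! ## Subgroups acting trivially: restriction and conjugation on homomorphisms -/

section Subgroup

variable (N : Subgroup G)

omit [IsTopologicalGroup G] in
/-- Restricting a cocycle of `G` to a subgroup `N` acting trivially gives an additive map:
`f(ab) = f(a) + f(b)` on `N` (even if `G` itself does not act trivially). Clark–Sharif 2010,
§3.5 (`res : H¹(K, E[P]) → H¹(K_P, E[P]) = Hom(𝔤_{K_P}, E[P])`). [folklore] -/
theorem resCocycle_map_mul_of_trivial (htriv : ∀ (n : N) (m : M), n • m = m)
    (f : contOneCocycles (discreteTopRep G M)) (a b : N) :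
    (resCocycle N f).1 (a * b) = (resCocycle N f).1 a + (resCocycle N f).1 b :=
  cocycle_map_mul_of_trivial htriv (resCocycle N f) a b

variable [N.Normal]

/-- **The conjugation action on homomorphisms.** For `N` normal acting trivially on `M` and
`c ∈ G`, the conjugate of the cocycle ( = continuous homomorphism) `f : N → M` is
`n ↦ c • f(c⁻¹ n c)` — the formula by which Clark–Sharif define `Nm(θ)(σ) = Σ_γ γ · θ(γ⁻¹ σ γ)`
on `H¹(K_P, E[P]) = Hom(𝔤_{K_P}, E[P])` (§3.5, before Lemma 15). [cite: ClarkSharif2010, §3.5] -/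
theorem conjCocycle_apply_of_trivial (c : G) (f : contOneCocycles (discreteTopRep N M)) (n : N) :
    (conjCocycle N c f).1 n = c • f.1 ⟨c⁻¹ * n * c, conj_mem_of_normal N c n⟩ :=
  rfl

/-- For `N` normal acting trivially on `M`, the conjugation action of an element `c ∈ N` on
`H¹(N, M)` is trivial already on cocycles: `c • f(c⁻¹ n c) = f(n)`. (On classes this holds for
any action, `conjH1_of_mem`; here there is one cocycle per class.) [folklore] -/
theorem conjCocycle_eq_of_mem_of_trivial (htriv : ∀ (n : N) (m : M), n • m = m) {c : G}
    (hc : c ∈ N) (f : contOneCocycles (discreteTopRep N M)) : conjCocycle N c f = f := by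
  apply Subtype.ext
  ext n
  rw [conjCocycle_apply]
  have h1 : subgroupConj N c n = ⟨c, hc⟩⁻¹ * n * ⟨c, hc⟩ := Subtype.ext (by simp [mul_assoc])
  rw [h1, cocycle_map_mul_of_trivial htriv, cocycle_map_mul_of_trivial htriv,
    cocycle_map_inv_of_trivial htriv, add_assoc, add_comm (f.1 n), ← add_assoc, neg_add_cancel,
    zero_add]
  exact htriv ⟨c, hc⟩ (f.1 n)

/-- The conjugation action on `H¹(N, M)` read on cocycles (trivial `N`-action):
`cocycleOf (c_* η) = c · cocycleOf η`. [cite: ClarkSharif2010, §3.5] -/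
theorem cocycleOf_conjH1 (htriv : ∀ (n : N) (m : M), n • m = m) (c : G) (η : subgroupH1 N M) :
    cocycleOf N M htriv (conjH1 N M c η) = conjCocycle N c (cocycleOf N M htriv η) := by
  conv_lhs => rw [← oneCocycleClass_cocycleOf htriv η, conjH1_oneCocycleClass]
  exact cocycleOf_oneCocycleClass htriv _

/-- **`Nm` on cocycles.** For `N` normal acting trivially on `M` and any finite family of
elements `γ_i ∈ G`, the endomorphism `Σ_i (γ_i)_*` of `H¹(N, M)` is, on the cocycle of a class,
`f ↦ (n ↦ Σ_i γ_i • f(γ_i⁻¹ n γ_i))` — Clark–Sharif's `Nm(θ)(σ) = Σ_{γ̄ ∈ Gal(K_P/K)} γ · θ(γ⁻¹σγ)`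
"where `γ` is a fixed lift of `γ̄` to `𝔤_K`", for the family of lifts (§3.5; with
`Literature.NumberTheory.EllipticCurves.ClarkSharif2010_lemma15`, `res ∘ cores` is this sum over a
system of coset representatives). [cite: ClarkSharif2010, §3.5] -/
theorem cocycleOf_sum_conjH1_apply (htriv : ∀ (n : N) (m : M), n • m = m) {ι : Type*}
    (s : Finset ι) (γ : ι → G) (η : subgroupH1 N M) (n : N) :
    (cocycleOf N M htriv (∑ i ∈ s, conjH1 N M (γ i) η)).1 n =
      ∑ i ∈ s, γ i • (cocycleOf N M htriv η).1 ⟨(γ i)⁻¹ * n * γ i, conj_mem_of_normal N (γ i) n⟩ := by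
  induction s using Finset.induction_on with
  | empty =>
    rw [Finset.sum_empty, Finset.sum_empty, ← oneCocycleClass_zero, cocycleOf_oneCocycleClass]
    rfl
  | insert i s hi ih =>
    rw [Finset.sum_insert hi, Finset.sum_insert hi, cocycleOf_add, add_apply_val, ih,
      cocycleOf_conjH1]
    rfl

end Subgroup

end Literature.NumberTheory.EllipticCurves
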